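import Mathlib
import Summits.MatrixMultiplication.MatrixMultiplication.Theses.SnSubsetDichotomy
import Summits.MatrixMultiplication.MatrixMultiplication.Theorems.SnSubsetDichotomyUmvirateDescent

/-!
# `SnSubsetDichotomy.JuntaBranch`, line `envelope-stability` — stub `stub_regularity`

One-point REGULARITY of TPP volume in `S_n` (crux stmt-MatrixMultiplication-8304, registered stub
`stub_regularity` of `Cruxes/JuntaBranch/Lines/envelope_stability.lean`): every TPP triple
`(A, B, C)` of `S_n` (`n ≥ 1`) descends to a TPP triple `(A', B', C')` of `S_{n-1}` keeping a
`1/n³` fraction of its volume, `|A||B||C| ≤ n³ |A'||B'||C'|`.  Consequence used by the glue of the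
line: `maxVol(n) ≤ n³ · maxVol(n-1)`.

Proof (folklore bookkeeping; cf. BlasiakChurchCohnGrochowUmans2017, proof of Thm. 4.2).
* Fix the target point `l := 0 : Fin n` (`n ≥ 1`).  For `X ⊆ S_n` the atoms
  `X ∩ {σ : σ i = l}`, `i ∈ Fin n`, partition `X` (they are the fibres of `σ ↦ σ⁻¹ l`), so the
  heaviest atom has at least `|X|/n` elements: `|X| ≤ n · |X ∩ {σ i_X = l}|` for some `i_X`
  (`exists_heavy_atom`; "the maximum is at least the mean", `Finset.card_eq_sum_card_fiberwise` and
  `Finset.sum_le_card_nsmul`).  This holds for `X = ∅` too, so no case split is needed.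
* Apply the tree theorem `umvirateDescent_proof : UmvirateDescent` (route item
  stmt-MatrixMultiplication-8308) at `t = 1` with the constant maps `I ≡ i_A`, `J ≡ i_B`, `P ≡ i_C`,
  `L ≡ l` (`Fin 1 → Fin n`, injective because `Fin 1` is a subsingleton): it returns a TPP triple
  `(A', B', C')` of `S_{n-1}` with `|A'| = |{σ ∈ A : ∀ k : Fin 1, σ i_A = l}| ≥ |A ∩ {σ i_A = l}|`
  and likewise for `B'`, `C'` (`card_le_of_descent`).
* Multiply: `|A||B||C| ≤ (n|A'|)(n|B'|)(n|C'|) = n³ |A'||B'||C'|` in `ℕ`, then cast to `ℝ`.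

No named facts are used; the result is unconditional.
-/

set_option linter.dupNamespace false

open Literature.Combinatorics.Additive
open Summit.MatrixMultiplication.MatrixMultiplication.Theses.SnSubsetDichotomy
open scoped Classical

namespace Summit.MatrixMultiplication.MatrixMultiplication.Theorems.JuntaBranch

/-- **The heaviest atom.**  For a target point `l : Fin n` and `X ⊆ S_n`, some source `i : Fin n`
has `|X| ≤ n · |{σ ∈ X : σ i = l}|`: the sets `{σ ∈ X : σ i = l}` are the fibres of
`σ ↦ σ⁻¹ l : X → Fin n`, and the largest of `n` fibres has at least the mean size. [folklore] -/
theorem exists_heavy_atom {n : ℕ} (l : Fin n) (X : Finset (Equiv.Perm (Fin n))) :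
    ∃ i : Fin n, X.card ≤ n * (X.filter (fun σ => σ i = l)).card := by
  have hne : (Finset.univ : Finset (Fin n)).Nonempty := ⟨l, Finset.mem_univ l⟩
  obtain ⟨i, -, hmax⟩ := Finset.exists_max_image (Finset.univ : Finset (Fin n))
    (fun j => (X.filter (fun σ => σ.symm l = j)).card) hne
  refine ⟨i, ?_⟩
  have hmaps : ∀ σ ∈ X, (fun σ : Equiv.Perm (Fin n) => σ.symm l) σ ∈ (Finset.univ : Finset (Fin n)) :=
    fun σ _ => Finset.mem_univ _
  have hsum := Finset.card_eq_sum_card_fiberwise hmaps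
  have hle := Finset.sum_le_card_nsmul (Finset.univ : Finset (Fin n))
    (fun j => (X.filter (fun σ => σ.symm l = j)).card) _ hmax
  have hfib : X.filter (fun σ => σ.symm l = i) = X.filter (fun σ => σ i = l) := by
    refine Finset.filter_congr (fun σ _ => ?_)
    rw [Equiv.symm_apply_eq, eq_comm]
  simp only [Finset.card_univ, Fintype.card_fin, smul_eq_mul] at hle
  rw [hfib] at hle
  exact hsum.trans_le hle

/-- **Bridge to the descent's filter.**  If `m = |{σ ∈ X : p σ}|` for a predicate `p` implied on `X`
by `σ i = l`, then `|X| ≤ n · |{σ ∈ X : σ i = l}|` gives `|X| ≤ n · m` (monotonicity of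
`Finset.card`; stated for an arbitrary decidability instance on `p` so that it applies verbatim to
the cardinalities returned by `UmvirateDescent`). [folklore] -/
theorem card_le_of_descent {n m : ℕ} {X : Finset (Equiv.Perm (Fin n))} {i l : Fin n}
    {p : Equiv.Perm (Fin n) → Prop} [DecidablePred p] (hm : m = (X.filter p).card)
    (hX : X.card ≤ n * (X.filter (fun σ => σ i = l)).card) (hp : ∀ σ ∈ X, σ i = l → p σ) :
    X.card ≤ n * m := by
  refine hX.trans (Nat.mul_le_mul_left _ ?_)
  rw [hm]
  refine Finset.card_le_card (fun σ hσ => ?_)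
  rw [Finset.mem_filter] at hσ ⊢
  exact ⟨hσ.1, hp σ hσ.1 hσ.2⟩

/-- **stub_regularity** (one-point REGULARITY of TPP volume; crux stmt-MatrixMultiplication-8304,
line `envelope-stability`).  Every TPP triple `(A, B, C)` of `S_n` (`n ≥ 1`) descends to a TPP
triple `(A', B', C')` of `S_{n-1}` with `|A||B||C| ≤ n³ |A'||B'||C'|`: fix the target point
`l = 0`; the atoms `A ∩ {σ i = l}` (`i ∈ Fin n`) partition `A`, so the heaviest has `≥ |A|/n`
elements (`exists_heavy_atom`), likewise for `B`, `C`; right-translate the three heavy atoms into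
`Stab(l) ≅ S_{n-1}` by `umvirateDescent_proof` (route item stmt-MatrixMultiplication-8308) at
`t = 1`, and multiply the three inequalities.  In particular `maxVol(n) ≤ n³ · maxVol(n-1)`.
[folklore; cf. BlasiakChurchCohnGrochowUmans2017, proof of Thm. 4.2] -/
theorem stub_regularity :
    ∀ n : ℕ, 1 ≤ n → ∀ A B C : Finset (Equiv.Perm (Fin n)), TripleProductProperty A B C →
    ∃ A' B' C' : Finset (Equiv.Perm (Fin (n - 1))), TripleProductProperty A' B' C' ∧
      ((A.card * B.card * C.card : ℕ) : ℝ) ≤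
        (n : ℝ) ^ (3 : ℕ) * ((A'.card * B'.card * C'.card : ℕ) : ℝ) := by
  intro n hn A B C hABC
  obtain ⟨iA, hA⟩ := exists_heavy_atom (⟨0, hn⟩ : Fin n) A
  obtain ⟨iB, hB⟩ := exists_heavy_atom (⟨0, hn⟩ : Fin n) B
  obtain ⟨iC, hC⟩ := exists_heavy_atom (⟨0, hn⟩ : Fin n) C
  obtain ⟨A', B', C', hTPP, hA', hB', hC'⟩ := umvirateDescent_proof n 1 hn (fun _ => iA)
    (fun _ => iB) (fun _ => iC) (fun _ => (⟨0, hn⟩ : Fin n)) (Function.injective_of_subsingleton _)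
    (Function.injective_of_subsingleton _) (Function.injective_of_subsingleton _)
    (Function.injective_of_subsingleton _) A B C hABC
  refine ⟨A', B', C', hTPP, ?_⟩
  have hA'' : A.card ≤ n * A'.card := card_le_of_descent hA' hA (fun _ _ h _ => h)
  have hB'' : B.card ≤ n * B'.card := card_le_of_descent hB' hB (fun _ _ h _ => h)
  have hC'' : C.card ≤ n * C'.card := card_le_of_descent hC' hC (fun _ _ h _ => h)
  have hnat : A.card * B.card * C.card ≤ n ^ 3 * (A'.card * B'.card * C'.card) :=
    calc A.card * B.card * C.card ≤ n * A'.card * (n * B'.card) * (n * C'.card) :=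
          Nat.mul_le_mul (Nat.mul_le_mul hA'' hB'') hC''
      _ = n ^ 3 * (A'.card * B'.card * C'.card) := by ring
  exact_mod_cast hnat

end Summit.MatrixMultiplication.MatrixMultiplication.Theorems.JuntaBranch
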